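import Mathlib.GroupTheory.Perm.Sign
import Literature.Computability.Complexity.MatchingLocalization
import Literature.Computability.Complexity.MatchingSymmetrization
import HarnessLib

/-!
# BBCHPRRWZ Theorem 4.9: effective derivations for the matching ideal

Braun–Brown-Cohen–Huq–Pokutta–Raghavendra–Roy–Weitz–Zink, *The matching problem has no small
symmetric SDP*, Math. Program. 165 (2017), Theorem 4.9: "For every polynomial `F`, if
`F ∈ ⟨𝒫_n⟩` then `F ≅_{(𝒫_n, 2 deg F - 1)} 0`."  We prove the VANISHING form for even `n` with the
bound `2 deg F` (the cell's typed `MatchingEffectiveDerivationV`, HOME/pnp-psdrank-p2/Sketch-v2.lean):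
a polynomial vanishing on all perfect matchings of `K_n` is derivable from `𝒫_n` in degree `2 deg F`
(`matchingEffectiveDerivationV`).

The proof is the paper's induction on the degree: the Claim `F ≅_{2d} σF` (`claim_perm`, from the
transposition case `claim_swap` by `Equiv.Perm.swap_induction_on`) followed by symmetrisation
(Lemma 4.7, `symmetrizationConstant`). The transposition case is organised through the
localization at a vertex (`localize`, Lemma 4.5) applied twice — at `a` in `K_n` and at the image
of `u` in `K_{n-2}` — and the local-to-global step `hasDerivationOfDegree_of_local` (Lemma 4.8),
with the induction hypothesis supplying the derivations of the degree-`(d-1)` coefficients on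
`K_{n-2}` and `K_{n-4}` (`MatchingLocalization.lean`, `MatchingRestriction.lean`).

## References

* G. Braun et al., *The matching problem has no small symmetric SDP*, Math. Program. 165 (2017)
  643–662, Thm. 4.9 (arXiv:1504.00703, p. 9). [BraunEtAl2016]
-/

noncomputable section

open MvPolynomial Finset
open Literature.Barriers.PneNP (IsPMOn exists_isPMOn_of_even)

namespace Literature.Computability.Complexity

namespace Mod2

/-! ### Generic facts -/

section Generic

variable {n : ℕ}

/-- Derivable polynomials vanish on perfect matchings. [cite: BraunEtAl2016, §4.2 (p. 7)] -/
theorem _root_.Literature.Computability.Complexity.HasDerivationOfDegree.vanishesOnPM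
    {F : MvPolynomial (KnEdge n) ℝ} {D : ℕ}
    (h : HasDerivationOfDegree (system n) F D) : VanishesOnPM F := by
  intro P hP
  rw [← isCong_zero_left_iff] at h
  rw [← h.eval_edgeIndicator_eq hP, map_zero]

/-- Scalar multiples of derivations. [cite: BraunEtAl2016, §4.2 (p. 7)] -/
theorem _root_.Literature.Computability.Complexity.HasDerivationOfDegree.smul
    {F : MvPolynomial (KnEdge n) ℝ} {D : ℕ}
    (h : HasDerivationOfDegree (system n) F D) (r : ℝ) : HasDerivationOfDegree (system n) (r • F) D := by
  rw [← isCong_zero_left_iff] at h ⊢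
  simpa using h.smul r

/-- Congruent polynomials: one vanishes on perfect matchings iff the other does.
[cite: BraunEtAl2016, §4.2 (p. 7)] -/
theorem _root_.Literature.Computability.Complexity.IsCong.vanishesOnPM
    {F G : MvPolynomial (KnEdge n) ℝ} {D : ℕ}
    (h : IsCong (system n) D F G) (hF : VanishesOnPM F) : VanishesOnPM G := fun P hP => by
  rw [← h.eval_edgeIndicator_eq hP]; exact hF P hP

/-- From `F ≅_D G` and a derivation of `G` in degree `D' ≥ D` one gets a derivation of `F`.
[cite: BraunEtAl2016, §4.2 (p. 7)] -/
theorem _root_.Literature.Computability.Complexity.IsCong.hasDerivationOfDegree_left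
    {F G : MvPolynomial (KnEdge n) ℝ} {D D' : ℕ}
    (h : IsCong (system n) D F G) (hD : D ≤ D') (hG : HasDerivationOfDegree (system n) G D') :
    HasDerivationOfDegree (system n) F D' := by
  have h1 : HasDerivationOfDegree (system n) (G - F) D' :=
    ((isCong_iff_hasDerivationOfDegree_sub.1 h).mono hD)
  have := hG.sub h1
  rwa [sub_sub_cancel] at this

/-- Degree of a combination of matching monomials. [cite: BraunEtAl2016, §4.3 (p. 8)] -/
theorem totalDegree_sum_smul_xM_le {κ : Type*} (J : Finset κ) (c : κ → ℝ) (N : κ → Finset (KnEdge n))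
    {k : ℕ} (hk : ∀ j ∈ J, (N j).card ≤ k) : (∑ j ∈ J, c j • xM (N j)).totalDegree ≤ k :=
  (totalDegree_finsetSum _ _).trans (Finset.sup_le fun j hj =>
    (totalDegree_smul_le _ _).trans ((totalDegree_xM_le _).trans (hk j hj)))

/-- Degree `0`: a polynomial of total degree `0` vanishing on the perfect matchings of `K_n`
(`n` even) is `0`. [cite: BraunEtAl2016, Thm. 4.9 (proof, "if d = 0 then F = 0")] -/
theorem eq_zero_of_totalDegree_eq_zero (hn : Even n) {F : MvPolynomial (KnEdge n) ℝ}
    (hF : F.totalDegree = 0) (hvan : VanishesOnPM F) : F = 0 := by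
  rw [totalDegree_eq_zero_iff_eq_C] at hF
  obtain ⟨P, hP⟩ := exists_isPMOn_of_even n (univ : Finset (Fin n)) (by simp) hn
  have h := hvan P hP
  rw [hF, eval_C] at h
  rw [hF, h, map_zero]

end Generic

/-! ### The vertices of pulled-back edge sets -/

section Pull

variable {m n : ℕ} (ι : Fin m ↪ Fin n)

/-- Vertices of a pull-back. [cite: BraunEtAl2016, Thm. 4.9 (proof)] -/
theorem mem_verts_pullEdges_of {N : Finset (KnEdge n)} (hN : ∀ v ∈ verts N, v ∈ Set.range ι)
    {v₀ : Fin m} (hv : ι v₀ ∈ verts N) : v₀ ∈ verts (pullEdges ι N) := by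
  obtain ⟨e, he, hve⟩ := mem_verts.1 hv
  obtain ⟨e₀, rfl⟩ := exists_edgeMap_eq ι (e := e) fun v hv' => hN v (mem_verts.2 ⟨_, he, hv'⟩)
  refine mem_verts.2 ⟨e₀, (mem_pullEdges ι).2 he, ?_⟩
  rw [coe_edgeMap, Sym2.mem_map] at hve
  obtain ⟨w, hw, hwv⟩ := hve
  rwa [← ι.injective hwv]

/-- Vertices of a pull-back, converse. [cite: BraunEtAl2016, Thm. 4.9 (proof)] -/
theorem mem_verts_of_mem_verts_pullEdges {N : Finset (KnEdge n)} {v₀ : Fin m}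
    (hv : v₀ ∈ verts (pullEdges ι N)) : ι v₀ ∈ verts N := by
  obtain ⟨e₀, he₀, hve⟩ := mem_verts.1 hv
  refine mem_verts.2 ⟨_, (mem_pullEdges ι).1 he₀, ?_⟩
  rw [coe_edgeMap, Sym2.mem_map]
  exact ⟨v₀, hve, rfl⟩

end Pull

/-! ### Book-keeping for the localization -/

section Loc

variable {m : ℕ} {κ : Type*} {w : Fin (m + 2)} {N : κ → Finset (KnEdge (m + 2))} {j : κ}

/-- `locR` of a set missing `w` is the set itself. [cite: BraunEtAl2016, Thm. 4.9 (proof)] -/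
theorem locR_of_not_mem (hw : w ∉ verts (N j)) : locR w N j = N j := by
  ext e
  rw [locR, mem_filter, and_iff_left_iff_imp]
  exact fun he hwe => hw (mem_verts.2 ⟨e, he, hwe⟩)

/-- `locR` of a partial matching covering `w` has one edge less.
[cite: BraunEtAl2016, Thm. 4.9 (proof)] -/
theorem card_locR_of_mem (hpm : IsPartialMatching (N j)) (hw : w ∈ verts (N j)) :
    (locR w N j).card + 1 = (N j).card := by
  obtain ⟨e₀, he₀, hwe₀⟩ := mem_verts.1 hw
  have hR : locR w N j = (N j).erase e₀ := by
    ext e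
    rw [locR, mem_filter, mem_erase]
    constructor
    · rintro ⟨he, hwe⟩; exact ⟨fun h => hwe (h ▸ hwe₀), he⟩
    · rintro ⟨hne, he⟩; exact ⟨he, fun hwe => hpm e he e₀ he₀ hne w ⟨hwe, hwe₀⟩⟩
  rw [hR, card_erase_of_mem he₀]
  have : 1 ≤ (N j).card := card_pos.2 ⟨e₀, he₀⟩
  omega

/-- `|locR| ≤ |N|`. [cite: BraunEtAl2016, Thm. 4.9 (proof)] -/
theorem card_locR_le : (locR w N j).card ≤ (N j).card := card_filter_le _ _

/-- `locR` is a partial matching. [cite: BraunEtAl2016, Thm. 4.9 (proof)] -/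
theorem isPartialMatching_locR (hpm : IsPartialMatching (N j)) : IsPartialMatching (locR w N j) :=
  fun e he f hf hef v hv => hpm e (mem_of_mem_filter e he) f (mem_of_mem_filter f hf) hef v hv

/-- A selected edge at a set missing `w` is a free edge there. [cite: BraunEtAl2016, Thm. 4.9 (proof)] -/
theorem mem_freeEdgesAt_of_sel (hw : w ∉ verts (N j)) {e : KnEdge (m + 2)} (he : e ∈ locSel w N j) :
    e ∈ freeEdgesAt (N j) w := by
  rw [locSel, if_neg hw] at he; exact he

/-- A selected edge at a set covering `w` belongs to it. [cite: BraunEtAl2016, Thm. 4.9 (proof)] -/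
theorem mem_of_sel (hw : w ∈ verts (N j)) {e : KnEdge (m + 2)} (he : e ∈ locSel w N j) : e ∈ N j := by
  rw [locSel, if_pos hw] at he; exact (mem_filter.1 he).1

end Loc

/-! ### The theorem, by induction on the degree -/

/-- BBCHPRRWZ Thm 4.9 (vanishing form, bound `2d`) for all even `n` at degree `≤ d`.
[cite: BraunEtAl2016, Thm. 4.9 (p. 9)] -/
def Thm49At (d : ℕ) : Prop :=
  ∀ n : ℕ, Even n → ∀ F : MvPolynomial (KnEdge n) ℝ, F.totalDegree ≤ d → VanishesOnPM F →
    HasDerivationOfDegree (system n) F (2 * d)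

/-- A family of embeddings missing a fixed vertex `w` and a variable one.
[cite: BraunEtAl2016, Thm. 4.9 (proof)] -/
theorem exists_emb_family {m : ℕ} (w : Fin (m + 2)) :
    ∃ ι : Fin (m + 2) → (Fin m ↪ Fin (m + 2)),
      ∀ b, b ≠ w → ∀ v : Fin (m + 2), v ∉ Set.range (ι b) ↔ v = w ∨ v = b := by
  classical
  have h : ∀ b : Fin (m + 2), ∃ ι : Fin m ↪ Fin (m + 2),
      b ≠ w → ∀ v : Fin (m + 2), v ∉ Set.range ι ↔ v = w ∨ v = b := by
    intro b
    by_cases hb : b = w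
    · obtain ⟨w', hw'⟩ : ∃ w' : Fin (m + 2), w' ≠ w := ⟨w + 1, by simp⟩
      obtain ⟨ι, -⟩ := exists_emb_compl_pair w w' hw'.symm
      exact ⟨ι, fun h => absurd hb h⟩
    · obtain ⟨ι, hι⟩ := exists_emb_compl_pair w b (Ne.symm hb)
      exact ⟨ι, fun _ => hι⟩
  choose ι hι using h
  exact ⟨ι, hι⟩

/-- **The transposition case of the Claim** (`F ≅_{2d} τF` for `τ = (a u)`), given Thm 4.9 below
degree `d`. [cite: BraunEtAl2016, Thm. 4.9 (proof, the Claim for a transposition)] -/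
theorem claim_swap {d : ℕ} (hd : 1 ≤ d) (IH : Thm49At (d - 1)) {m : ℕ} (hm : Even m)
    (a u : Fin (m + 2)) (hau : a ≠ u) (F : MvPolynomial (KnEdge (m + 2)) ℝ) (hF : F.totalDegree ≤ d)
    (hvan : VanishesOnPM F) :
    HasDerivationOfDegree (system (m + 2)) (F - polyPerm (Equiv.swap a u) F) (2 * d) := by
  classical
  have hm1 : m ≠ 1 := fun h => by subst h; exact absurd hm (by decide)
  set τ := Equiv.swap a u with hτ
  set G := F - polyPerm τ F with hG
  -- degree and vanishing of `G`
  have hGdeg : G.totalDegree ≤ d :=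
    (totalDegree_sub _ _).trans (max_le hF (by rw [totalDegree_polyPerm]; exact hF))
  have hGvan : VanishesOnPM G := fun P hP => by
    rw [hG, map_sub, hvan P hP, vanishes_polyPerm τ hvan P hP, sub_zero]
  -- normal form
  set J := G.support.filter (fun α => IsPartialMatching α.support) with hJ
  set c : (KnEdge (m + 2) →₀ ℕ) → ℝ := fun α => coeff α G with hc
  set N : (KnEdge (m + 2) →₀ ℕ) → Finset (KnEdge (m + 2)) := fun α => α.support with hN
  have hNF : IsCong (system (m + 2)) d G (∑ α ∈ J, c α • xM (N α)) := by
    have h := (isCong_normalForm G).mono hGdeg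
    rw [hJ, sum_filter]
    exact h
  have hpmJ : ∀ α ∈ J, IsPartialMatching (N α) := fun α hα => (mem_filter.1 hα).2
  have hcardJ : ∀ α ∈ J, (N α).card ≤ d := fun α hα =>
    (card_support_le_degree α).trans ((le_totalDegree (mem_filter.1 hα).1).trans hGdeg)
  -- every monomial of `G` touches `a` or `u`
  have htouch : ∀ α ∈ J, a ∈ verts (N α) ∨ u ∈ verts (N α) := by
    intro α hα
    by_contra h
    push Not at h
    have hmem := (mem_filter.1 hα).1
    rw [mem_support_iff] at hmem
    apply hmem
    -- `coeff α (τF) = coeff α F`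
    have hfix : Finsupp.mapDomain (edgeMap τ τ.injective) α = α := by
      conv_rhs => rw [← Finsupp.mapDomain_id (v := α)]
      refine Finsupp.mapDomain_congr fun e he => ?_
      apply Subtype.ext
      rw [coe_edgeMap]
      obtain ⟨p, q, -, hpq⟩ := exists_coe_eq_mk e
      rw [hpq, Sym2.map_mk, hτ]
      have hp : p ≠ a ∧ p ≠ u := by
        constructor
        · rintro rfl; exact h.1 (mem_verts.2 ⟨e, he, by rw [hpq]; exact Sym2.mem_mk_left _ _⟩)
        · rintro rfl; exact h.2 (mem_verts.2 ⟨e, he, by rw [hpq]; exact Sym2.mem_mk_left _ _⟩)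
      have hq : q ≠ a ∧ q ≠ u := by
        constructor
        · rintro rfl; exact h.1 (mem_verts.2 ⟨e, he, by rw [hpq]; exact Sym2.mem_mk_right _ _⟩)
        · rintro rfl; exact h.2 (mem_verts.2 ⟨e, he, by rw [hpq]; exact Sym2.mem_mk_right _ _⟩)
      rw [Equiv.swap_apply_of_ne_of_ne hp.1 hp.2, Equiv.swap_apply_of_ne_of_ne hq.1 hq.2]
      exact hpq.symm
    have hcoeff : coeff α (polyPerm τ F) = coeff α F := by
      rw [polyPerm, ← hfix, coeff_rename_mapDomain _ (edgeMap_injective _ _), hfix]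
    rw [hG, coeff_sub, hcoeff, sub_self]
  -- level 1: localize at `a`
  obtain ⟨ι₁, hι₁⟩ := exists_emb_family (m := m) a
  have hloc₁ := localize (w := a) ι₁ hι₁ J c N hpmJ (t := d + 1)
    (fun α hα _ => Nat.add_le_add_right (hcardJ α hα) 1)
  set D₁ := locD a ι₁ J c N with hD₁
  set H₁ := ∑ b ∈ univ.erase a, Hterm a ι₁ D₁ b with hH₁
  have hGH : IsCong (system (m + 2)) (d + 1) G H₁ := (hNF.mono (Nat.le_succ d)).trans hloc₁
  have hH₁van : VanishesOnPM H₁ := hGH.vanishesOnPM hGvan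
  -- the coefficients `D₁ b` are derivable in degree `2d - 1` once they vanish
  have hder₁ : ∀ b, b ≠ a → VanishesOnPM (D₁ b) → HasDerivationOfDegree (system m) (D₁ b) (2 * d - 1) := by
    intro b hba hDvan
    -- the terms of `D₁ b`
    set J₂ := J.filter (fun α => ∃ h : b ≠ a, newEdge a b (Ne.symm h) ∈ locSel a N α) with hJ₂
    set N₁ : (KnEdge (m + 2) →₀ ℕ) → Finset (KnEdge m) := fun α => pullEdges (ι₁ b) (locR a N α) with hN₁
    have hDb : D₁ b = ∑ α ∈ J₂, c α • xM (N₁ α) := rfl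
    have hsel : ∀ α ∈ J₂, newEdge a b (Ne.symm hba) ∈ locSel a N α := fun α hα => by
      obtain ⟨-, ⟨_, h⟩⟩ := mem_filter.1 hα; exact h
    have hJ₂J : ∀ α ∈ J₂, α ∈ J := fun α hα => (mem_filter.1 hα).1
    have hpm₁ : ∀ α ∈ J₂, IsPartialMatching (N₁ α) := fun α hα =>
      isPartialMatching_pullEdges _ (isPartialMatching_locR (hpmJ α (hJ₂J α hα)))
    have havoid : ∀ α ∈ J₂, ∀ v ∈ verts (locR a N α), v ∈ Set.range (ι₁ b) := fun α hα =>
      verts_locR_subset_range ι₁ hι₁ (hpmJ α (hJ₂J α hα)) hba (hsel α hα)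
    -- size book-keeping: type 1 (`a` covered): `|N₁| ≤ d - 1`; type 2: `|N₁| ≤ d` and `u` covered
    have hsize : ∀ α ∈ J₂, (N₁ α).card + 1 ≤ d ∨
        ((N₁ α).card ≤ d ∧ ∃ hu : u ∈ Set.range (ι₁ b), (Classical.choose hu) ∈ verts (N₁ α)) := by
      intro α hα
      have hcard : (N₁ α).card = (locR a N α).card := card_pullEdges _ (havoid α hα)
      by_cases ha : a ∈ verts (N α)
      · left
        rw [hcard, card_locR_of_mem (hpmJ α (hJ₂J α hα)) ha]
        exact hcardJ α (hJ₂J α hα)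
      · right
        have hu : u ∈ verts (N α) := (htouch α (hJ₂J α hα)).resolve_left ha
        have hR : locR a N α = N α := locR_of_not_mem ha
        refine ⟨by rw [hcard, hR]; exact hcardJ α (hJ₂J α hα), ?_⟩
        have hur : u ∈ Set.range (ι₁ b) := by
          by_contra hnot
          rcases (hι₁ b hba u).1 hnot with h | h
          · exact hau.symm h
          · -- `u = b`: but `{a,b} = {a,u}` free at `a` would need `u ∉ verts (N α)`
            subst h
            have hfree := mem_freeEdgesAt_of_sel ha (hsel α hα)
            exact (mem_freeEdgesAt.1 hfree).2 u hu (Sym2.mem_mk_right _ _)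
        refine ⟨hur, ?_⟩
        have hspec := Classical.choose_spec hur
        apply mem_verts_pullEdges_of _ (havoid α hα)
        rw [hspec, hR]; exact hu
    by_cases hbu : b = u
    · -- `b = u`: all terms are of type 1, degree `≤ d - 1`; the induction hypothesis applies
      subst hbu
      have hdeg : (D₁ b).totalDegree ≤ d - 1 := by
        rw [hDb]
        refine totalDegree_sum_smul_xM_le _ _ _ fun α hα => ?_
        rcases hsize α hα with h | ⟨-, hu, hmem⟩
        · omega
        · exfalso
          have hspec := Classical.choose_spec hu
          exact ((hι₁ b hba b).2 (Or.inr rfl)) ⟨_, hspec⟩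
      exact (IH m hm (D₁ b) hdeg hDvan).mono (by omega)
    · -- `b ∉ {a, u}`: localize `D₁ b` once more, at the preimage `u₁` of `u`
      have hur : u ∈ Set.range (ι₁ b) := by
        by_contra hnot
        rcases (hι₁ b hba u).1 hnot with h | h
        · exact hau.symm h
        · exact hbu h.symm
      obtain ⟨u₁, hu₁⟩ := hur
      -- `m = m' + 2`
      obtain ⟨m', rfl⟩ : ∃ m', m = m' + 2 := by
        rcases m with _ | _ | m'
        · exact absurd u₁.isLt (by omega)
        · exact absurd rfl hm1
        · exact ⟨m', rfl⟩
      have hm' : Even m' := by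
        obtain ⟨k, hk⟩ := hm; exact ⟨k - 1, by omega⟩
      have hm'1 : m' ≠ 1 := fun h => by subst h; exact absurd hm' (by decide)
      obtain ⟨ι₂, hι₂⟩ := exists_emb_family (m := m') u₁
      -- sizes at level 2: terms missing `u₁` have `|N₁| + 1 ≤ d`
      have ht₂ : ∀ α ∈ J₂, u₁ ∉ verts (N₁ α) → (N₁ α).card + 1 ≤ d := by
        intro α hα hu₁'
        rcases hsize α hα with h | ⟨-, hu, hmem⟩
        · exact h
        · exfalso
          have hspec := Classical.choose_spec hu
          have : Classical.choose hu = u₁ := (ι₁ b).injective (hspec.trans hu₁.symm)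
          rw [this] at hmem
          exact hu₁' hmem
      have hloc₂ := localize (w := u₁) ι₂ hι₂ J₂ c N₁ hpm₁ (t := d) ht₂
      set D₂ := locD u₁ ι₂ J₂ c N₁ with hD₂
      set H₂ := ∑ v ∈ univ.erase u₁, Hterm u₁ ι₂ D₂ v with hH₂
      rw [← hDb] at hloc₂
      have hH₂van : VanishesOnPM H₂ := hloc₂.vanishesOnPM hDvan
      -- the level-2 coefficients have degree `≤ d - 1`: induction hypothesis
      have hder₂ : ∀ v, v ≠ u₁ → VanishesOnPM (D₂ v) →
          HasDerivationOfDegree (system m') (D₂ v) (2 * (d - 1)) := by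
        intro v hv hvan₂
        refine IH m' hm' (D₂ v) ?_ hvan₂
        rw [hD₂, locD]
        refine totalDegree_sum_smul_xM_le _ _ _ fun α hα => ?_
        obtain ⟨hαJ₂, ⟨_, hselv⟩⟩ := mem_filter.1 hα
        have havoid₂ := verts_locR_subset_range ι₂ hι₂ (hpm₁ α hαJ₂) hv hselv
        rw [card_pullEdges _ havoid₂]
        by_cases hu₁' : u₁ ∈ verts (N₁ α)
        · have := card_locR_of_mem (w := u₁) (hpm₁ α hαJ₂) hu₁'
          rcases hsize α hαJ₂ with h | ⟨h, -⟩ <;> omega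
        · rw [locR_of_not_mem hu₁']
          have := ht₂ α hαJ₂ hu₁'
          omega
      have hH₂ := hasDerivationOfDegree_of_local hm'1 u₁ ι₂ hι₂ D₂ hder₂ hH₂van
      have h2 : 2 * (d - 1) + 1 = 2 * d - 1 := by omega
      rw [h2] at hH₂
      exact hloc₂.hasDerivationOfDegree_left (by omega) hH₂
  have hH₁ := hasDerivationOfDegree_of_local hm1 a ι₁ hι₁ D₁ hder₁ hH₁van
  have h1 : 2 * d - 1 + 1 = 2 * d := by omega
  rw [h1] at hH₁
  exact hGH.hasDerivationOfDegree_left (by omega) hH₁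

/-- **The Claim**: `F ≅_{2d} σF` for every vertex permutation `σ`, given Thm 4.9 below degree `d`.
[cite: BraunEtAl2016, Thm. 4.9 (proof, the Claim)] -/
theorem claim_perm {d : ℕ} (hd : 1 ≤ d) (IH : Thm49At (d - 1)) {n : ℕ} (hn : Even n)
    (F : MvPolynomial (KnEdge n) ℝ) (hF : F.totalDegree ≤ d) (hvan : VanishesOnPM F)
    (σ : Equiv.Perm (Fin n)) : HasDerivationOfDegree (system n) (F - polyPerm σ F) (2 * d) := by
  induction σ using Equiv.Perm.swap_induction_on with
  | one => rw [polyPerm_one, sub_self]; exact HasDerivationOfDegree.zero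
  | swap_mul σ x y hxy ih =>
    -- `F - (τσ)F = (F - τF) + τ(F - σF)`
    have hsplit : F - polyPerm (Equiv.swap x y * σ) F =
        (F - polyPerm (Equiv.swap x y) F) + polyPerm (Equiv.swap x y) (F - polyPerm σ F) := by
      rw [polyPerm_mul, map_sub]; ring
    rw [hsplit]
    refine HasDerivationOfDegree.add ?_ (ih.perm _)
    -- the transposition case needs `n = m + 2`
    obtain ⟨m, rfl⟩ : ∃ m, n = m + 2 := ⟨n - 2, by have := x.isLt; have := y.isLt; omega⟩
    have hm : Even m := by obtain ⟨k, hk⟩ := hn; exact ⟨k - 1, by omega⟩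
    exact claim_swap hd IH hm x y hxy F hF hvan

/-- **BBCHPRRWZ Theorem 4.9** (vanishing form, all degrees). [cite: BraunEtAl2016, Thm. 4.9 (p. 9)] -/
theorem thm49At : ∀ d : ℕ, Thm49At d := by
  intro d
  induction d using Nat.strong_induction_on with
  | _ d ih =>
  intro n hn F hF hvan
  classical
  rcases Nat.eq_zero_or_pos d with rfl | hd
  · -- degree `0`
    have hF0 : F.totalDegree = 0 := Nat.le_zero.1 hF
    rw [eq_zero_of_totalDegree_eq_zero hn hF0 hvan]
    exact HasDerivationOfDegree.zero
  · have IH : Thm49At (d - 1) := ih (d - 1) (by omega)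
    -- the Claim for all `σ`, summed: `n! F - Σ_σ σF` is derivable
    have hsum : HasDerivationOfDegree (system n)
        (∑ σ : Equiv.Perm (Fin n), (F - polyPerm σ F)) (2 * d) :=
      HasDerivationOfDegree.sum fun σ _ => claim_perm hd IH hn F hF hvan σ
    rw [sum_sub_distrib, sum_const, card_univ] at hsum
    -- symmetrisation: `Σ_σ σF ≅_d c`
    obtain ⟨c, hc⟩ := symmetrizationConstant F
    have hc' : HasDerivationOfDegree (system n) ((∑ σ : Equiv.Perm (Fin n), polyPerm σ F) - C c) (2 * d) := by
      have h := (isCong_iff_hasDerivationOfDegree_sub.1 hc.symm)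
      exact h.mono (hF.trans (by omega))
    have hFc : HasDerivationOfDegree (system n) ((Fintype.card (Equiv.Perm (Fin n))) • F - C c) (2 * d) := by
      have := hsum.add hc'
      rwa [sub_add_sub_cancel] at this
    -- `c = 0` by evaluating at a perfect matching
    obtain ⟨P, hP⟩ := exists_isPMOn_of_even n (univ : Finset (Fin n)) (by simp) hn
    have hc0 : c = 0 := by
      have h := hFc.vanishesOnPM P hP
      rw [map_sub, map_nsmul, hvan P hP, smul_zero, eval_C, zero_sub, neg_eq_zero] at h
      exact h
    rw [hc0, map_zero, sub_zero] at hFc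
    -- divide by `n!`
    have hne : (Fintype.card (Equiv.Perm (Fin n)) : ℝ) ≠ 0 := by
      exact_mod_cast Fintype.card_ne_zero
    have := hFc.smul ((Fintype.card (Equiv.Perm (Fin n)) : ℝ)⁻¹)
    rwa [← Nat.cast_smul_eq_nsmul ℝ, smul_smul, inv_mul_cancel₀ hne, one_smul] at this

/-- **BBCHPRRWZ Theorem 4.9, vanishing form** (the cell's typed `MatchingEffectiveDerivationV`,
HOME/pnp-psdrank-p2/Sketch-v2.lean §2c, verbatim): for even `n`, a polynomial vanishing at `χ^M`
for every perfect matching `M` of `K_n` is derivable from `𝒫_n` in degree `2 · deg F`.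
[cite: BraunEtAl2016, Thm. 4.9 (p. 9)] -/
theorem matchingEffectiveDerivationV :
    ∀ n : ℕ, Even n → ∀ F : MvPolynomial (KnEdge n) ℝ,
      (∀ M : Finset (Sym2 (Fin n)), IsPMOn univ M → MvPolynomial.eval (edgeIndicator M) F = 0) →
        HasDerivationOfDegree (Mod2.system n) F (2 * F.totalDegree) :=
  fun n hn F hF => thm49At F.totalDegree n hn F le_rfl hF

/-- **The Claim of Thm 4.9** (the cell's typed `PermutationCongruence`, Sketch-v2.lean §2c,
verbatim): a polynomial vanishing on the perfect matchings is derivably congruent to each of its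
vertex-permutes in degree `2 · deg F`. [cite: BraunEtAl2016, Thm. 4.9 (proof, the Claim)] -/
theorem permutationCongruence :
    ∀ n : ℕ, Even n → ∀ F : MvPolynomial (KnEdge n) ℝ,
      (∀ M : Finset (Sym2 (Fin n)), IsPMOn univ M → MvPolynomial.eval (edgeIndicator M) F = 0) →
      ∀ σ : Equiv.Perm (Fin n),
        HasDerivationOfDegree (Mod2.system n) (F - polyPerm σ F) (2 * F.totalDegree) := by
  intro n hn F hF σ
  rcases Nat.eq_zero_or_pos F.totalDegree with h0 | hd
  · rw [eq_zero_of_totalDegree_eq_zero hn h0 hF, map_zero, sub_zero]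
    exact HasDerivationOfDegree.zero
  · exact claim_perm hd (thm49At _) hn F le_rfl hF σ

/-- **BBCHPRRWZ Theorem 4.9, ideal form** (the cell's typed `MatchingEffectiveDerivation`,
Sketch-v2.lean §2c, verbatim): for even `n`, every `F ∈ ⟨𝒫_n⟩` is derivable from `𝒫_n` in degree
`2 · deg F` (`2 deg F - 1` in print). [cite: BraunEtAl2016, Thm. 4.9 (p. 9)] -/
theorem matchingEffectiveDerivation :
    ∀ n : ℕ, Even n → ∀ F : MvPolynomial (KnEdge n) ℝ,
      F ∈ Ideal.span (Set.range (Mod2.system n)) →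
        HasDerivationOfDegree (Mod2.system n) F (2 * F.totalDegree) := by
  intro n hn F hF
  refine matchingEffectiveDerivationV n hn F fun M hM => ?_
  have hle : Ideal.span (Set.range (system n)) ≤ RingHom.ker (eval (edgeIndicator M)) := by
    rw [Ideal.span_le]
    rintro _ ⟨p, rfl⟩
    exact RingHom.mem_ker.2 (eval_system_edgeIndicator hM p)
  exact RingHom.mem_ker.1 (hle hF)

end Mod2

end Literature.Computability.Complexity
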